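import Summits.CriticalPhenomena.Ising3DConformalLimit.Theses.SubPtolemyInterlacing

/-!
# `SubPtolemyFloor` (item stmt-CriticalPhenomena-15703): the threshold `log₂(1+√2)` is tight for the route

Negative / structural knowledge about the crux
`Summit.CriticalPhenomena.Ising3DConformalLimit.Theses.SubPtolemyInterlacing.SubPtolemyFloor` (route
SubPtolemyInterlacing, r3), from its standing crux disprover (D-0016); THEOREM-ONLY, no new definitions.

The route consumes r3 only through the sign of the Ptolemy-balanced Gaussian test at `x⋆ = (0,2,3,6)e₁`:
`U₄(x⋆) ≤ s₁s₃·(1 - 2u - u²)` with `u = 2^{-2Δ}` and `2Δ ≤ a` (proved glue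
`Theorems.interlacingForcesU4_u4_balanced_neg`, `…_two_mul_dim_le_of_axialFloor`). Here:

* `rpow_neg_threshold` — `2^{-log₂(1+√2)} = √2 - 1`;
* `balancedTest_neg_iff` — `1 - 2·2^{-t} - (2^{-t})² < 0 ↔ t < log₂(1+√2)`;
* `balancedTest_eq_zero_at_threshold` — equality (Ptolemy's theorem / the planar balance) AT the threshold;
* `balancedTest_nonneg_of_threshold_le` — for `t ≥ log₂(1+√2)` the test carries NO sign.

So the hypothesis `a < log₂(1+√2)` of r3 is load-bearing to the last digit: it cannot be relaxed to
`a ≤ log₂(1+√2)` nor to any larger constant without the route's mechanism losing the sign of `U₄(x⋆)`;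
conversely no weaker floor than r3 feeds the assembly (route KILL CRITERIA: "no weaker floor feeds the
Ptolemy threshold").
-/

noncomputable section

namespace Summit.CriticalPhenomena.Ising3DConformalLimit.SubPtolemyFloorNegative

/-- `2^{-log₂(1+√2)} = (1+√2)⁻¹ = √2 - 1`. [folklore] -/
theorem rpow_neg_threshold : (2:ℝ) ^ (-(Real.logb 2 (1 + Real.sqrt 2))) = Real.sqrt 2 - 1 := by
  have hpos : 0 < 1 + Real.sqrt 2 := by positivity
  rw [Real.rpow_neg (by norm_num), Real.rpow_logb (by norm_num) (by norm_num) hpos]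
  have hs : Real.sqrt 2 ^ 2 = 2 := Real.sq_sqrt (by norm_num)
  have hkey : (1 + Real.sqrt 2) * (Real.sqrt 2 - 1) = 1 := by nlinarith [hs]
  exact inv_eq_of_mul_eq_one_right hkey

/-- **The balanced sign test**: `1 - 2u - u² < 0 ↔ t < log₂(1+√2)` for `u = 2^{-t}`
(`1 - 2u - u² = 2 - (u+1)²`, negative iff `u > √2 - 1 = 2^{-log₂(1+√2)}`). [folklore] -/
theorem balancedTest_neg_iff {t : ℝ} :
    1 - 2 * (2:ℝ) ^ (-t) - ((2:ℝ) ^ (-t)) ^ 2 < 0 ↔ t < Real.logb 2 (1 + Real.sqrt 2) := by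
  have hs : Real.sqrt 2 ^ 2 = 2 := Real.sq_sqrt (by norm_num)
  have key : 1 - 2 * (2:ℝ) ^ (-t) - ((2:ℝ) ^ (-t)) ^ 2 < 0 ↔ Real.sqrt 2 - 1 < (2:ℝ) ^ (-t) := by
    constructor
    · intro h
      by_contra hle
      rw [not_lt] at hle
      have h3 : 0 ≤ (Real.sqrt 2 - ((2:ℝ) ^ (-t) + 1)) * (Real.sqrt 2 + ((2:ℝ) ^ (-t) + 1)) :=
        mul_nonneg (by linarith) (by linarith [Real.sqrt_nonneg 2, Real.rpow_nonneg zero_le_two (-t)])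
      nlinarith [h3, hs, h]
    · intro h
      have h3 : 0 < ((2:ℝ) ^ (-t) + 1 - Real.sqrt 2) * ((2:ℝ) ^ (-t) + 1 + Real.sqrt 2) :=
        mul_pos (by linarith) (by linarith [Real.sqrt_nonneg 2, Real.rpow_nonneg zero_le_two (-t)])
      nlinarith [h3, hs]
  rw [key, ← rpow_neg_threshold, Real.rpow_lt_rpow_left_iff one_lt_two]
  constructor <;> intro h <;> linarith

/-- **Equality AT the threshold** (Ptolemy's theorem: the crossing pairing balances the two non-crossing
ones). [folklore] -/
theorem balancedTest_eq_zero_at_threshold :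
    1 - 2 * (2:ℝ) ^ (-(Real.logb 2 (1 + Real.sqrt 2))) -
      ((2:ℝ) ^ (-(Real.logb 2 (1 + Real.sqrt 2)))) ^ 2 = 0 := by
  rw [rpow_neg_threshold]
  have hs : Real.sqrt 2 ^ 2 = 2 := Real.sq_sqrt (by norm_num)
  linear_combination (-1 : ℝ) * hs

/-- **No sign above the threshold**: for `t ≥ log₂(1+√2)` the balanced test is `≥ 0` — an axial floor with
exponent `a ≥ log₂(1+√2)` (e.g. the conditional DCP value `3/2`, or Simon–Lieb's `2`) gives the route
nothing. [folklore] -/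
theorem balancedTest_nonneg_of_threshold_le {t : ℝ} (ht : Real.logb 2 (1 + Real.sqrt 2) ≤ t) :
    0 ≤ 1 - 2 * (2:ℝ) ^ (-t) - ((2:ℝ) ^ (-t)) ^ 2 :=
  not_lt.1 fun h => (not_lt.2 ht) (balancedTest_neg_iff.1 h)

/-- **Strict sign below**: for `t < log₂(1+√2)` the test is `< 0` (the direction the proved glue uses,
restated on the `t`-axis). [folklore] -/
theorem balancedTest_neg_of_lt_threshold {t : ℝ} (ht : t < Real.logb 2 (1 + Real.sqrt 2)) :
    1 - 2 * (2:ℝ) ^ (-t) - ((2:ℝ) ^ (-t)) ^ 2 < 0 :=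
  balancedTest_neg_iff.2 ht

end Summit.CriticalPhenomena.Ising3DConformalLimit.SubPtolemyFloorNegative

end
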